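import Mathlib.RingTheory.MvPolynomial.Ideal
import Literature.Computability.AlgebraicComplexity.CosetComplexity
import Literature.Computability.AlgebraicComplexity.PermanentIrreducible
import HarnessLib

/-!
# Collision profiles, the collision ideals `J_r(n)` and the collision complexity `κ_r(n)`

Topic `Literature/Computability/AlgebraicComplexity`; definition item `defn-collisionIdeal`
(requested by route `ValiantsHypothesis/ForgivenCollisions`, whose items inline all three notions).

We work in `k[x_{ij} : i, j < n] = MvPolynomial (Fin n × Fin n) k` over a commutative semiring `k`
(the route uses `k = ℂ` and `k = ℝ≥0`). For an exponent vector `d : Fin n × Fin n →₀ ℕ` the tree's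
`rowCount d i = ∑_j d (i, j)` and `colCount d j = ∑_i d (i, j)` (`PermanentIrreducible.lean`) are
the degrees of the monomial `x^d` in the variables of row `i`, resp. column `j`.

* `IsCollisionBad r d` — the **collision profile** predicate `Bad_r`: some row or some column of `d`
  has degree `≥ 3`, or at least `r` rows-or-columns have degree `≥ 2`
  ("a tripled line, or at least `r` doubly occupied lines"). It is an upper set in `d`
  (`IsCollisionBad.mono`) and antitone in `r` (`IsCollisionBad.anti`); `Bad_0` is everything,
  `Bad_1 d ↔` some line has degree `≥ 2` (`isCollisionBad_one_iff`; so `¬ Bad_1 d` iff `x^d` is a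
  placement of non-attacking rooks, `not_isCollisionBad_one_iff`), and `Bad_r = Bad_{2n+1}` for
  `r > 2n` (`isCollisionBad_iff_of_two_mul_lt`). Permutation monomials are never bad for `r ≥ 1`
  (`not_isCollisionBad_permMonomial`).
* `collisionIdeal k r n = J_r(n)` — the **collision ideal**: the monomial ideal
  `Ideal.span {x^d | Bad_r d}`. Because `Bad_r` is an upper set, Mathlib's monomial-ideal criterion
  `MvPolynomial.mem_ideal_span_monomial_image` gives `f ∈ J_r(n) ↔ supp f ⊆ Bad_r`
  (`mem_collisionIdeal_iff_support`, `mem_collisionIdeal_iff_coeff_eq_zero`), and over a ring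
  `P - Q ∈ J_r(n) ↔ P, Q have the same coefficient at every non-bad exponent`
  (`sub_mem_collisionIdeal_iff`). `J_0 = ⊤ ⊇ J_1 ⊇ J_2 ⊇ ⋯` (`collisionIdeal_zero`,
  `collisionIdeal_anti`), `J_r = J_{2n+1}` for `r > 2n` (`collisionIdeal_eq_of_two_mul_lt`), and
  `per_n ∉ J_r(n)` for `r ≥ 1` (`perPoly_not_mem_collisionIdeal`).
* `collisionComplexity k r n = κ_r(n) := cosetComplexity (J_r(n)) per_n` — the least circuit
  complexity (`complexity`, Bürgisser 2000, Def. 2.1, tree `ArithCircuit.lean`) of a polynomial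
  congruent to the generic permanent `perPoly (Fin n) k` modulo `J_r(n)`: an instance of the
  "complexity of a (nonzero) coset of an ideal" of Andrews–Forbes 2022, §1.3 and Grochow–Pitassi
  2018, §6 (tree `CosetComplexity.lean`). It is monotone in `r` (`collisionComplexity_mono`),
  bounded by `complexity per_n` (`collisionComplexity_le_complexity_perPoly`), `κ_0 = 0` over a ring
  (`collisionComplexity_zero`), and its lower/upper bounds read as statements about polynomials
  agreeing with `per_n` off `Bad_r` (`le_collisionComplexity_iff`, `collisionComplexity_le_iff`).

## Sources

* [AndrewsForbes2022] R. Andrews, M. A. Forbes, *Ideals, determinants, and straightening*, STOC 2022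
  (arXiv:2112.00792), §1.3: "circuit lower bounds for nonzero cosets of ideals".
* [GrochowPitassi2018] J. A. Grochow, T. Pitassi, *Circuit complexity, proof complexity, and
  polynomial identity testing*, J. ACM 65 (2018), §6 (the certificates of a fixed system form a
  coset of an ideal).
* [Burgisser2000] P. Bürgisser, *Completeness and Reduction in Algebraic Complexity Theory*,
  Def. 2.1 (the measure `complexity`), (2.2) (the generic permanent).

## Design choices

* The bodies are *literally* the forms inlined in the route file
  `Summits/ValiantsHypothesis/ValiantsHypothesis/Theses/ForgivenCollisions.lean`:
  `IsCollisionBad r d` unfolds (`Iff.rfl`, `isCollisionBad_iff`) to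
  `(∃ i, 3 ≤ rowCount d i) ∨ (∃ j, 3 ≤ colCount d j) ∨ r ≤ #{i | 2 ≤ rowCount d i} + #{j | …}`
  (filters of `Finset.univ`), `collisionIdeal k r n` is by `rfl` (`collisionIdeal_def`) the
  `Ideal.span ((fun d => monomial d 1) '' {d | …})` of the route, and `collisionComplexity ℂ r n`
  is by `rfl` the route's `cosetComplexity (Ideal.span …) (perPoly (Fin n) ℂ)`; so every route item
  can be restated over the new names by definitional unfolding.
* Index type `Fin n` and parameters `(r n : ℕ)` as requested (the route quantifies over `n : ℕ` and
  uses `Fin (k + l)`); the coefficient semiring `k` is an explicit argument of `collisionIdeal` and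
  `collisionComplexity` (it cannot be inferred from `r n`), as for the sibling `detIdeal`.
* Everything is stated for a commutative semiring `k` except the statements needing subtraction or
  `cosetComplexity_top` (`sub_mem_collisionIdeal_iff`, `collisionComplexity_zero`,
  `le_collisionComplexity_iff`, `collisionComplexity_le_iff`), which assume a commutative ring.
* Reused, not redefined: `rowCount`, `colCount`, `permMonomial`, `perPoly`, `cosetComplexity`,
  `complexity`, Mathlib's `Ideal.span` / `MvPolynomial.mem_ideal_span_monomial_image`
  (`lean search collisionIdeal|IsCollisionBad|collisionComplexity`: no prior hits; the tree's
  `Literature.Order.WellQuasiOrder.monomialIdeal` is the same span but over a `CommRing` and in the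
  well-quasi-order story, so it is not imported here).

## What is not here

No bounds on `κ_r(n)` for specific `r` (those are the route's items: syndrome upper bound, rungs,
monotone versions), no syndrome polynomials, no border / constant-free variants, and no general
finite index type (replace `Fin n` by a `Fintype` verbatim if ever needed).
-/

noncomputable section

open MvPolynomial

namespace Literature.Computability.AlgebraicComplexity

universe u

/-! ### Monotonicity of row and column counts -/

section Counts

variable {m : Type*} [Fintype m]

/-- `rowCount` is monotone in the exponent vector. [folklore] -/
theorem rowCount_mono {d d' : (m × m) →₀ ℕ} (h : d ≤ d') (i : m) : rowCount d i ≤ rowCount d' i :=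
  Finset.sum_le_sum fun c _ => Finsupp.le_def.1 h (i, c)

/-- `colCount` is monotone in the exponent vector. [folklore] -/
theorem colCount_mono {d d' : (m × m) →₀ ℕ} (h : d ≤ d') (j : m) : colCount d j ≤ colCount d' j :=
  Finset.sum_le_sum fun i _ => Finsupp.le_def.1 h (i, j)

end Counts

/-! ### The collision profile `Bad_r` -/

section Bad

variable {n : ℕ}

/-- The **collision profile** predicate `Bad_r(d)` of an exponent vector `d` of `k[x_{ij}]_{i,j<n}`:
some row of `d` has degree `≥ 3`, or some column has degree `≥ 3`, or the number of rows of degree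
`≥ 2` plus the number of columns of degree `≥ 2` is at least `r` ("a tripled line, or at least `r`
doubly occupied lines"). The monomials `x^d` with `Bad_r d` span the collision ideal `J_r(n)`
(`collisionIdeal`). [folklore] -/
def IsCollisionBad (r : ℕ) (d : Fin n × Fin n →₀ ℕ) : Prop :=
  (∃ i : Fin n, 3 ≤ rowCount d i) ∨ (∃ j : Fin n, 3 ≤ colCount d j) ∨
    r ≤ (Finset.univ.filter fun i : Fin n => 2 ≤ rowCount d i).card +
      (Finset.univ.filter fun j : Fin n => 2 ≤ colCount d j).card

/-- Unfolding lemma: `IsCollisionBad r d` is, by `Iff.rfl`, the disjunction inlined in the route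
`ValiantsHypothesis/ForgivenCollisions`. [folklore] -/
theorem isCollisionBad_iff (r : ℕ) (d : Fin n × Fin n →₀ ℕ) :
    IsCollisionBad r d ↔
      (∃ i : Fin n, 3 ≤ rowCount d i) ∨ (∃ j : Fin n, 3 ≤ colCount d j) ∨
        r ≤ (Finset.univ.filter fun i : Fin n => 2 ≤ rowCount d i).card +
          (Finset.univ.filter fun j : Fin n => 2 ≤ colCount d j).card :=
  Iff.rfl

/-- The number of doubly occupied rows is monotone in the exponent vector. [folklore] -/
theorem card_filter_two_le_rowCount_mono {d d' : Fin n × Fin n →₀ ℕ} (h : d ≤ d') :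
    (Finset.univ.filter fun i : Fin n => 2 ≤ rowCount d i).card ≤
      (Finset.univ.filter fun i : Fin n => 2 ≤ rowCount d' i).card :=
  Finset.card_le_card fun i hi => by
    simp only [Finset.mem_filter, Finset.mem_univ, true_and] at hi ⊢
    exact hi.trans (rowCount_mono h i)

/-- The number of doubly occupied columns is monotone in the exponent vector. [folklore] -/
theorem card_filter_two_le_colCount_mono {d d' : Fin n × Fin n →₀ ℕ} (h : d ≤ d') :
    (Finset.univ.filter fun j : Fin n => 2 ≤ colCount d j).card ≤
      (Finset.univ.filter fun j : Fin n => 2 ≤ colCount d' j).card :=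
  Finset.card_le_card fun j hj => by
    simp only [Finset.mem_filter, Finset.mem_univ, true_and] at hj ⊢
    exact hj.trans (colCount_mono h j)

/-- There are at most `2n` doubly occupied lines. [folklore] -/
theorem card_filter_rowCount_add_card_filter_colCount_le (d : Fin n × Fin n →₀ ℕ) :
    (Finset.univ.filter fun i : Fin n => 2 ≤ rowCount d i).card +
        (Finset.univ.filter fun j : Fin n => 2 ≤ colCount d j).card ≤ 2 * n := by
  have h₁ := Finset.card_filter_le (Finset.univ : Finset (Fin n)) fun i => 2 ≤ rowCount d i
  have h₂ := Finset.card_filter_le (Finset.univ : Finset (Fin n)) fun j => 2 ≤ colCount d j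
  rw [Finset.card_univ, Fintype.card_fin] at h₁ h₂
  omega

/-- `Bad_r` is an **upper set** in the exponent vector: if `x^d` is bad then so is every multiple
`x^{d'}`, `d ≤ d'` (row/column counts and the numbers of doubly occupied lines are monotone).
[folklore] -/
theorem IsCollisionBad.mono {r : ℕ} {d d' : Fin n × Fin n →₀ ℕ} (h : d ≤ d')
    (hd : IsCollisionBad r d) : IsCollisionBad r d' := by
  rcases hd with ⟨i, hi⟩ | ⟨j, hj⟩ | hr
  · exact Or.inl ⟨i, hi.trans (rowCount_mono h i)⟩
  · exact Or.inr (Or.inl ⟨j, hj.trans (colCount_mono h j)⟩)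
  · exact Or.inr (Or.inr (hr.trans (Nat.add_le_add (card_filter_two_le_rowCount_mono h)
      (card_filter_two_le_colCount_mono h))))

/-- `{d | Bad_r d}` is an upper set of `Fin n × Fin n →₀ ℕ`. [folklore] -/
theorem isUpperSet_setOf_isCollisionBad (r : ℕ) :
    IsUpperSet {d : Fin n × Fin n →₀ ℕ | IsCollisionBad r d} :=
  fun _ _ h hd => hd.mono h

/-- `Bad_r` is **antitone in `r`**: `r ≤ r' → Bad_{r'} ⊆ Bad_r`. [folklore] -/
theorem IsCollisionBad.anti {r r' : ℕ} (h : r ≤ r') {d : Fin n × Fin n →₀ ℕ}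
    (hd : IsCollisionBad r' d) : IsCollisionBad r d :=
  hd.imp_right (Or.imp_right h.trans)

/-- `Bad_0` is everything. [folklore] -/
theorem isCollisionBad_zero (d : Fin n × Fin n →₀ ℕ) : IsCollisionBad 0 d :=
  Or.inr (Or.inr (Nat.zero_le _))

/-- `Bad_1 d` iff some row or some column of `d` has degree `≥ 2` (a degree `≥ 3` line has degree
`≥ 2`, and "at least one doubly occupied line" is literally this). [folklore] -/
theorem isCollisionBad_one_iff (d : Fin n × Fin n →₀ ℕ) :
    IsCollisionBad 1 d ↔ (∃ i : Fin n, 2 ≤ rowCount d i) ∨ ∃ j : Fin n, 2 ≤ colCount d j := by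
  constructor
  · rintro (⟨i, hi⟩ | ⟨j, hj⟩ | h)
    · exact Or.inl ⟨i, le_of_lt hi⟩
    · exact Or.inr ⟨j, le_of_lt hj⟩
    · by_contra hcon
      simp only [not_or, not_exists, not_le] at hcon
      have hA : (Finset.univ.filter fun i : Fin n => 2 ≤ rowCount d i) = ∅ :=
        Finset.filter_eq_empty_iff.2 fun i _ => not_le.2 (hcon.1 i)
      have hB : (Finset.univ.filter fun j : Fin n => 2 ≤ colCount d j) = ∅ :=
        Finset.filter_eq_empty_iff.2 fun j _ => not_le.2 (hcon.2 j)
      rw [hA, hB, Finset.card_empty] at h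
      exact Nat.not_succ_le_zero 0 h
  · rintro (⟨i, hi⟩ | ⟨j, hj⟩)
    · refine Or.inr (Or.inr (le_trans ?_ (Nat.le_add_right _ _)))
      exact Finset.card_pos.2 ⟨i, by simp [hi]⟩
    · refine Or.inr (Or.inr (le_trans ?_ (Nat.le_add_left _ _)))
      exact Finset.card_pos.2 ⟨j, by simp [hj]⟩

/-- `¬ Bad_1 d` iff every row and every column of `d` has degree `≤ 1`, i.e. `x^d` is a placement of
non-attacking rooks on the `n × n` board (a partial permutation matrix). [folklore] -/
theorem not_isCollisionBad_one_iff (d : Fin n × Fin n →₀ ℕ) :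
    ¬ IsCollisionBad 1 d ↔ (∀ i : Fin n, rowCount d i ≤ 1) ∧ ∀ j : Fin n, colCount d j ≤ 1 := by
  rw [isCollisionBad_one_iff, not_or, not_exists, not_exists]
  refine and_congr (forall_congr' fun i => ?_) (forall_congr' fun j => ?_) <;> omega

/-- For `r > 2n` the third alternative is void (there are at most `2n` lines): `Bad_r d` iff some
line has degree `≥ 3`. [folklore] -/
theorem isCollisionBad_iff_of_two_mul_lt {r : ℕ} (h : 2 * n < r) (d : Fin n × Fin n →₀ ℕ) :
    IsCollisionBad r d ↔ (∃ i : Fin n, 3 ≤ rowCount d i) ∨ ∃ j : Fin n, 3 ≤ colCount d j := by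
  have := card_filter_rowCount_add_card_filter_colCount_le d
  constructor
  · rintro (hi | hj | hr)
    · exact Or.inl hi
    · exact Or.inr hj
    · omega
  · rintro (hi | hj)
    · exact Or.inl hi
    · exact Or.inr (Or.inl hj)

/-- Hence the profiles stabilise: `Bad_r = Bad_{2n+1}` for `r > 2n`. [folklore] -/
theorem isCollisionBad_iff_two_mul_add_one {r : ℕ} (h : 2 * n < r) (d : Fin n × Fin n →₀ ℕ) :
    IsCollisionBad r d ↔ IsCollisionBad (2 * n + 1) d := by
  rw [isCollisionBad_iff_of_two_mul_lt h, isCollisionBad_iff_of_two_mul_lt (Nat.lt_succ_self _)]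

/-- **Permutation monomials are never bad** (for `r ≥ 1`): every row and column count of `μ_ρ` is
`1`. [folklore] -/
theorem not_isCollisionBad_permMonomial {r : ℕ} (hr : 1 ≤ r) (ρ : Equiv.Perm (Fin n)) :
    ¬ IsCollisionBad r (permMonomial ρ) := by
  rintro (⟨i, hi⟩ | ⟨j, hj⟩ | h)
  · rw [rowCount_permMonomial] at hi
    omega
  · rw [colCount_permMonomial] at hj
    omega
  · have h₁ : (Finset.univ.filter fun i : Fin n => 2 ≤ rowCount (permMonomial ρ) i) = ∅ :=
      Finset.filter_eq_empty_iff.2 fun i _ => by rw [rowCount_permMonomial]; omega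
    have h₂ : (Finset.univ.filter fun j : Fin n => 2 ≤ colCount (permMonomial ρ) j) = ∅ :=
      Finset.filter_eq_empty_iff.2 fun j _ => by rw [colCount_permMonomial]; omega
    rw [h₁, h₂, Finset.card_empty] at h
    omega

end Bad

/-! ### The collision ideal `J_r(n)` -/

section Ideal

variable (k : Type u) [CommSemiring k] {n : ℕ}

/-- The **collision ideal** `J_r(n) ⊆ k[x_{ij}]_{i,j<n}`: the monomial ideal spanned by the
monomials `x^d` with a bad collision profile `Bad_r d` (`IsCollisionBad`) — some line of degree
`≥ 3`, or at least `r` doubly occupied lines. `J_0 = ⊤ ⊇ J_1 ⊇ J_2 ⊇ ⋯`, constant from `r = 2n + 1`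
on. Its cosets are the objects whose circuit complexity the collision complexity `κ_r(n)`
(`collisionComplexity`) measures. [folklore] -/
def collisionIdeal (r n : ℕ) : Ideal (MvPolynomial (Fin n × Fin n) k) :=
  Ideal.span ((fun d : Fin n × Fin n →₀ ℕ => monomial d (1 : k)) '' {d | IsCollisionBad r d})

/-- Unfolding lemma: `collisionIdeal k r n` is, by `rfl`, the `Ideal.span` inlined in the route
`ValiantsHypothesis/ForgivenCollisions`. [folklore] -/
theorem collisionIdeal_def (r n : ℕ) :
    collisionIdeal k r n =
      Ideal.span ((fun d : Fin n × Fin n →₀ ℕ => monomial d (1 : k)) ''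
        {d | (∃ i : Fin n, 3 ≤ rowCount d i) ∨ (∃ j : Fin n, 3 ≤ colCount d j) ∨
          r ≤ (Finset.univ.filter fun i : Fin n => 2 ≤ rowCount d i).card +
            (Finset.univ.filter fun j : Fin n => 2 ≤ colCount d j).card}) :=
  rfl

variable {k}

/-- **Membership in the collision ideal is a support condition**: `f ∈ J_r(n)` iff every exponent
in the support of `f` is bad — Mathlib's monomial-ideal criterion
`MvPolynomial.mem_ideal_span_monomial_image` plus the fact that `Bad_r` is an upper set.
[folklore] -/
theorem mem_collisionIdeal_iff_support {r : ℕ} {f : MvPolynomial (Fin n × Fin n) k} :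
    f ∈ collisionIdeal k r n ↔ ∀ d ∈ f.support, IsCollisionBad r d := by
  rw [collisionIdeal, mem_ideal_span_monomial_image]
  refine forall₂_congr fun d _ => ⟨?_, fun hd => ⟨d, hd, le_rfl⟩⟩
  rintro ⟨d', hd', hle⟩
  exact IsCollisionBad.mono hle hd'

/-- Equivalently: `f ∈ J_r(n)` iff the coefficient of `f` at every exponent that is *not* bad
vanishes. [folklore] -/
theorem mem_collisionIdeal_iff_coeff_eq_zero {r : ℕ} {f : MvPolynomial (Fin n × Fin n) k} :
    f ∈ collisionIdeal k r n ↔ ∀ d, ¬ IsCollisionBad r d → coeff d f = 0 := by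
  rw [mem_collisionIdeal_iff_support]
  refine ⟨fun h d hd => ?_, fun h d hd => ?_⟩
  · by_contra hne
    exact hd (h d (mem_support_iff.2 hne))
  · by_contra hbad
    exact (mem_support_iff.1 hd) (h d hbad)

/-- A bad monomial (with any coefficient) lies in `J_r(n)`. [folklore] -/
theorem monomial_mem_collisionIdeal {r : ℕ} {d : Fin n × Fin n →₀ ℕ} (hd : IsCollisionBad r d)
    (c : k) : monomial d c ∈ collisionIdeal k r n := by
  classical
  refine mem_collisionIdeal_iff_support.2 fun d' hd' => ?_
  rw [Finset.mem_singleton.1 (support_monomial_subset hd')]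
  exact hd

/-- A monomial with nonzero coefficient lies in `J_r(n)` iff its exponent is bad. [folklore] -/
theorem monomial_mem_collisionIdeal_iff {r : ℕ} {d : Fin n × Fin n →₀ ℕ} {c : k} (hc : c ≠ 0) :
    monomial d c ∈ collisionIdeal k r n ↔ IsCollisionBad r d := by
  classical
  refine ⟨fun h => mem_collisionIdeal_iff_support.1 h d ?_,
    fun hd => monomial_mem_collisionIdeal hd c⟩
  rw [support_monomial, if_neg hc]
  exact Finset.mem_singleton_self d

/-- The collision ideals are **antitone in `r`**: `r ≤ r' → J_{r'}(n) ≤ J_r(n)`. [folklore] -/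
theorem collisionIdeal_anti {r r' : ℕ} (h : r ≤ r') :
    collisionIdeal k r' n ≤ collisionIdeal k r n :=
  Ideal.span_mono (Set.image_mono fun _ hd => IsCollisionBad.anti h hd)

variable (k)

/-- `r ↦ J_r(n)` is an antitone chain of ideals. [folklore] -/
theorem collisionIdeal_antitone (n : ℕ) : Antitone fun r => collisionIdeal k r n :=
  fun _ _ h => collisionIdeal_anti h

/-- `J_0(n) = ⊤` (the constant monomial is bad for `r = 0`). [folklore] -/
@[simp]
theorem collisionIdeal_zero (n : ℕ) : collisionIdeal k 0 n = ⊤ :=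
  (Ideal.eq_top_iff_one _).2 (monomial_mem_collisionIdeal (isCollisionBad_zero 0) 1)

/-- The chain stabilises: `J_r(n) = J_{2n+1}(n)` for `r > 2n`. [folklore] -/
theorem collisionIdeal_eq_of_two_mul_lt {r : ℕ} (h : 2 * n < r) :
    collisionIdeal k r n = collisionIdeal k (2 * n + 1) n := by
  simp only [collisionIdeal, isCollisionBad_iff_two_mul_add_one h]

/-- **The permanent does not lie in any `J_r(n)`, `r ≥ 1`** (over a nontrivial `k`): its support
consists of permutation monomials, which are not bad. [folklore] -/
theorem perPoly_not_mem_collisionIdeal [Nontrivial k] {r : ℕ} (hr : 1 ≤ r) :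
    perPoly (Fin n) k ∉ collisionIdeal k r n := fun h =>
  not_isCollisionBad_permMonomial hr 1 (mem_collisionIdeal_iff_support.1 h _ (by
    rw [mem_support_iff, coeff_permMonomial_perPoly]
    exact one_ne_zero))

end Ideal

section IdealRing

variable {k : Type u} [CommRing k] {n : ℕ}

/-- Over a ring, **congruence modulo `J_r(n)` is coefficient agreement off `Bad_r`**:
`P - Q ∈ J_r(n)` iff `P` and `Q` have the same coefficient at every exponent that is not bad.
[folklore] -/
theorem sub_mem_collisionIdeal_iff {r : ℕ} {P Q : MvPolynomial (Fin n × Fin n) k} :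
    P - Q ∈ collisionIdeal k r n ↔ ∀ d, ¬ IsCollisionBad r d → coeff d P = coeff d Q := by
  simp only [mem_collisionIdeal_iff_coeff_eq_zero, coeff_sub, sub_eq_zero]

end IdealRing

/-! ### The collision complexity `κ_r(n)` -/

section Complexity

variable (k : Type u) [CommSemiring k] {n : ℕ}

/-- The **collision complexity** `κ_r(n) = cosetComplexity (J_r(n)) per_n`: the least circuit
complexity (`complexity`, Bürgisser 2000, Def. 2.1) of a polynomial in the coset `per_n + J_r(n)` of
the generic permanent `perPoly (Fin n) k` modulo the collision ideal — over a ring, the least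
complexity of a polynomial having coefficient `1` at every permutation monomial and `0` at every
other exponent that is not `Bad_r` (`collisionComplexity_le_iff`). An instance of the complexity
of a nonzero coset of an ideal (Andrews–Forbes 2022, §1.3; Grochow–Pitassi 2018, §6; tree
`cosetComplexity`). [cite: AndrewsForbes2022, §1.3] -/
def collisionComplexity (r n : ℕ) : ℕ :=
  cosetComplexity (collisionIdeal k r n) (perPoly (Fin n) k)

/-- Unfolding lemma for `collisionComplexity` (by `rfl`; with `collisionIdeal_def` this is the
`cosetComplexity (Ideal.span …) (perPoly (Fin n) ℂ)` inlined in the route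
`ValiantsHypothesis/ForgivenCollisions`). [folklore] -/
theorem collisionComplexity_def (r n : ℕ) :
    collisionComplexity k r n = cosetComplexity (collisionIdeal k r n) (perPoly (Fin n) k) :=
  rfl

/-- `κ_r(n) ≤ complexity per_n`: the permanent lies in its own coset. [folklore] -/
theorem collisionComplexity_le_complexity_perPoly (r n : ℕ) :
    collisionComplexity k r n ≤ complexity (perPoly (Fin n) k) :=
  cosetComplexity_le_complexity _ _

/-- `κ_r(n)` is **monotone in `r`** (the ideals shrink, `cosetComplexity_anti`). [folklore] -/
theorem collisionComplexity_mono {r r' : ℕ} (h : r ≤ r') (n : ℕ) :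
    collisionComplexity k r n ≤ collisionComplexity k r' n :=
  cosetComplexity_anti (collisionIdeal_anti h) _

/-- `r ↦ κ_r(n)` is monotone. [folklore] -/
theorem collisionComplexity_monotone (n : ℕ) : Monotone fun r => collisionComplexity k r n :=
  fun _ _ h => collisionComplexity_mono k h n

/-- `κ_r(n) = κ_{2n+1}(n)` for `r > 2n`. [folklore] -/
theorem collisionComplexity_eq_of_two_mul_lt {r : ℕ} (h : 2 * n < r) :
    collisionComplexity k r n = collisionComplexity k (2 * n + 1) n := by
  rw [collisionComplexity, collisionIdeal_eq_of_two_mul_lt k h, collisionComplexity]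

end Complexity

section ComplexityRing

variable (k : Type u) [CommRing k] {n : ℕ}

/-- Over a ring, `κ_0(n) = 0` (`J_0 = ⊤`, and the coset `⊤` contains `0`). [folklore] -/
@[simp]
theorem collisionComplexity_zero (n : ℕ) : collisionComplexity k 0 n = 0 := by
  rw [collisionComplexity, collisionIdeal_zero, cosetComplexity_top]

variable {k}

/-- **Lower bounds for `κ_r(n)`** (over a ring): `B ≤ κ_r(n)` iff every polynomial agreeing with
`per_n` at all exponents that are not `Bad_r` has complexity `≥ B`. [folklore] -/
theorem le_collisionComplexity_iff {r : ℕ} {B : ℕ} :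
    B ≤ collisionComplexity k r n ↔ ∀ P : MvPolynomial (Fin n × Fin n) k,
      (∀ d, ¬ IsCollisionBad r d → coeff d P = coeff d (perPoly (Fin n) k)) → B ≤ complexity P := by
  rw [collisionComplexity, le_cosetComplexity_iff]
  constructor
  · intro h P hP
    have hg : P - perPoly (Fin n) k ∈ collisionIdeal k r n := sub_mem_collisionIdeal_iff.2 hP
    simpa only [add_sub_cancel] using h _ hg
  · intro h g hg
    refine h _ (sub_mem_collisionIdeal_iff.1 ?_)
    rwa [add_sub_cancel_left]

/-- **Upper bounds for `κ_r(n)`** (over a ring): `κ_r(n) ≤ B` iff some polynomial agreeing with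
`per_n` at all exponents that are not `Bad_r` has complexity `≤ B`. [folklore] -/
theorem collisionComplexity_le_iff {r : ℕ} {B : ℕ} :
    collisionComplexity k r n ≤ B ↔ ∃ P : MvPolynomial (Fin n × Fin n) k,
      (∀ d, ¬ IsCollisionBad r d → coeff d P = coeff d (perPoly (Fin n) k)) ∧ complexity P ≤ B := by
  rw [collisionComplexity, cosetComplexity_le_iff_sub_mem]
  simp only [sub_mem_collisionIdeal_iff]

end ComplexityRing

end Literature.Computability.AlgebraicComplexity
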